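import Summits.QuantumAdvantage.AdviceFreeQNC0.FibreDecimation37
import HarnessLib

/-!
# Cell qa-qnc0, `p = 3` — ROUND-37P2 File A/B: algebra of the general-direction characters `χ_δ` (inputs of Lemma 37.D)

Planner qa-qnc0-p2 g37, ROUND-37P2 §2 (proof of Lemma 37.D), over `Exp37.chiDir` (`FibreDecimation37.lean`):

* `omega_pow_val_add` — `ω^{a.val} · ω^{b.val} = ω^{(a+b).val}` (`ω³ = 1`);
* **`chiDir_add`** — `χ_δ · χ_{δ'} = χ_{δ+δ'}`;  **`chiDir_sq`** — `χ_δ² = χ_{−δ} = χ_{2δ}` (Frobenius);  `chiDir_zero` — `χ_0 = 1`;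
* **`chiDir_eq_pow`** — `χ_δ(w) = ω^{⟨δ,w⟩.val}` with `⟨δ,w⟩ = Σ_{w_i} δ_i ∈ 𝔽₃`;
* **`test_eq_tr`** — the MOD-3 test as a trace: `[⟨δ,w⟩ + ρ ≢ 0] = tr(ω^{ρ.val} · χ_δ(w))` (as elements of `𝔽₄`), the first line of the proof of 37.D.

WHAT THIS IS NOT: Lemma 37.D (i)–(iii) and Theorem 37.F are not attempted; crux 22907 untouched; no separation.
-/

noncomputable section

namespace Summit.QuantumAdvantage.AdviceFreeQNC0.Exp37

open Finset
open Summit.QuantumAdvantage.AdviceFreeQNC0 F4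

variable {m : ℕ}

/-- Exponents of `ω` add in `𝔽₃`: `ω^{a.val}·ω^{b.val} = ω^{(a+b).val}`. -/
theorem omega_pow_val_add (a b : ZMod 3) : ω ^ a.val * ω ^ b.val = ω ^ (a + b).val := by
  rw [← pow_add, omega_pow_mod (a.val + b.val), ZMod.val_add]

/-- **`χ_δ · χ_{δ'} = χ_{δ+δ'}`.** -/
theorem chiDir_add (δ δ' : Fin m → ZMod 3) (w : Fin m → Bool) :
    chiDir δ w * chiDir δ' w = chiDir (δ + δ') w := by
  unfold chiDir
  rw [← Finset.prod_mul_distrib]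
  refine Finset.prod_congr rfl fun i _ => ?_
  by_cases h : w i = true
  · rw [if_pos h, if_pos h, if_pos h, Pi.add_apply, omega_pow_val_add]
  · rw [if_neg h, if_neg h, if_neg h, one_mul]

/-- `χ_0 = 1`. -/
theorem chiDir_zero (w : Fin m → Bool) : chiDir (0 : Fin m → ZMod 3) w = 1 := by
  unfold chiDir
  exact Finset.prod_eq_one fun i _ => by simp

/-- **Frobenius: `χ_δ² = χ_{δ+δ} = χ_{−δ}`.** -/
theorem chiDir_sq (δ : Fin m → ZMod 3) (w : Fin m → Bool) : chiDir δ w ^ 2 = chiDir (-δ) w := by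
  rw [pow_two, chiDir_add]
  congr 1
  funext i
  rw [Pi.add_apply, Pi.neg_apply]
  have : (2 : ZMod 3) = -1 := by decide
  linear_combination (δ i) * this

/-- **`χ_δ(w) = ω^{⟨δ,w⟩}`** with the pairing `⟨δ,w⟩ = Σ_{i : w_i} δ_i ∈ 𝔽₃`. -/
theorem chiDir_eq_pow (δ : Fin m → ZMod 3) (w : Fin m → Bool) :
    chiDir δ w = ω ^ (∑ i, if w i then δ i else 0).val := by
  classical
  unfold chiDir
  induction (univ : Finset (Fin m)) using Finset.induction_on with
  | empty => simp
  | insert j s hj ih =>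
    rw [Finset.prod_insert hj, Finset.sum_insert hj, ih]
    by_cases h : w j = true
    · rw [if_pos h, if_pos h, omega_pow_val_add]
    · rw [if_neg h, if_neg h, one_mul, zero_add]

/-- `t.val ≡ 0 (mod 3)` iff `t = 0` (`t.val < 3`). -/
theorem val_mod_three (t : ZMod 3) : t.val % 3 = 0 ↔ t = 0 := by
  constructor
  · intro h
    have ht : t.val < 3 := ZMod.val_lt t
    have hv : t.val = 0 := by omega
    exact (ZMod.val_eq_zero t).1 hv
  · rintro rfl; simp

/-- **The MOD-3 test as a trace**: `[⟨δ,w⟩ + ρ ≢ 0] = tr(ω^{ρ} · χ_δ(w))` in `𝔽₄`. -/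
theorem test_eq_tr (δ : Fin m → ZMod 3) (ρ : ZMod 3) (w : Fin m → Bool) :
    (if (∑ i, if w i then δ i else 0) + ρ ≠ 0 then (1 : F4) else 0) = tr (ω ^ ρ.val * chiDir δ w) := by
  rw [chiDir_eq_pow, mul_comm, omega_pow_val_add, tr_omega_pow]
  by_cases h : (∑ i, if w i then δ i else 0) + ρ = 0
  · rw [if_neg (not_not.2 h), if_pos ((val_mod_three _).2 h)]
  · rw [if_pos h, if_neg (fun h' => h ((val_mod_three _).1 h'))]

end Summit.QuantumAdvantage.AdviceFreeQNC0.Exp37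

end
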